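import Literature.Geometry.Kaehler.ComplexTorusMaximalRealMultiplicationHodgeEqLefschetz
import Literature.Geometry.Kaehler.ComplexTorusAbelianSurfaceRealMultiplicationHodgeLieAlgebraDimension
import Literature.Geometry.Kaehler.ComplexTorusPicardNumbersRecursion
import HarnessLib

/-!
# Ribet 1983 Thm. 1 (`d = e`) ∕ Moonen–Zarhin 1999 (2.3) I(3): `dim Hg(X) = dim_ℝ 𝔥𝔤_ℝ = dim_ℂ 𝔤 = dim Lf(X) = 3g` for
# `End⁰(X)` a TOTALLY REAL FIELD OF DEGREE `g = dim X` (`Hg(X) = Res_{F/ℚ} SL_{2,F}`, `dim = [F:ℚ] · dim SL₂`), and the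
# front-ends for SIMPLE abelian varieties with maximal real multiplication — at `g = 3`: a simple abelian THREEFOLD of
# Albert type I has `End⁰(X) = ℚ` (`dim Hg = 21`) or a totally real cubic field (`dim Hg = 9`), and is stably nondegenerate

Layer `Literature/Geometry/Kaehler`, namespace `Literature.Geometry.Kaehler.ComplexTorus`; lane `lit-hodgefound`
(Track 2 foundations library), Layer A4; prover seat `lit-hodgefound-p17` (generation 50), self-proposed row g50-#4 —
the dimension count and the simple-variety front-ends of the maximal-real-multiplication programme (g50-#1 Ribet's
large-image lemma for `n` planes, g50-#2 `𝔤 ⊇ ∏_σ 𝔰𝔩(V_σ)`, g50-#3 `Hg = Lf`, stably nondegenerate).  ENGINE: g50-#1's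
`finrank_eq_three_mul_card_of_iSup_eq_top` (`𝔊 ≅ ∏ⱼ 𝔰𝔩(Wⱼ)` by restriction, `dim = 3n`) on the `g = [K:ℚ]` eigenplanes,
exactly as generation 49 counted `6 = 2 · 3` for real quadratic `K` (g49-#4
`IsRiemannForm.finrank_hodgeGroupComplexLie_eq_six_of_finrank_eq_two`).  THEOREMS ONLY (no definition, no instance, no
notation, no named fact; D-0026, net debt 0); nothing restated — consumed BY NAME besides the above: g49-#3's
criterion `IsRiemannForm.hodgeGroupC_eq_lefschetzIdentityC_iff_finrank_eq` (`dim 𝔩𝔣 = dim 𝔥𝔤` once `Hg(ℂ) = Lf(ℂ)`),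
g48-#2's `End⁰(X) = val(K)` for `[F : K] = 1` (`IsSimple.range_valAlgHom_eq_endAlgRat_of_finrank_eq_one`), the
threefold facts `IsSimple.finrank_centerField_endAlgRat_eq_one_of_finrank_eq_three` (`End⁰` of a simple threefold is
its centre) and `IsSimple.finrank_centerField_dvd_of_isTotallyReal` (`e ∣ g`), and the `End⁰(X) = ℚ` threefold
(`ComplexTorusAbelianSurfaceHodgeGeneral` §g=3: `Hg = Sp₆`, `dim 21`, stably nondegenerate).

## Sources, VERBATIM (held copies; `p0NNN Lnn` = chunk file and line of the materialised text)

* B. B. Gordon, *A survey of the Hodge conjecture for abelian varieties* (1997∕1999), held `paper:arxiv-alg-geom_9709030`,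
  Thm. 6.3 (p0018 L51–L60): «([B.94] Theorems 1–3) […] `End⁰A` is a totally real field of degree `e` over `ℚ`, and `d/e`
  is odd […] Then `Hg(A) = Lf(A)` and thus `Hdg(Aⁿ) = Div(Aⁿ)` for `n ≥ 1`»; Corollary (p0018 L62–L66): «When `A` is a
  simple abelian variety of prime dimension, then `Hdg(Aⁿ) = Div(Aⁿ)` for `n ≥ 1`»; sketch (p0018 L98–L112):
  «`Hg(A,ℂ) ≃ ∏_{σ ∈ Hom(K,ℂ)} Sp(U_σ, ψ_σ)`».  [B.94] = Ribet 1983 (Amer. J. Math. 105), not held — cited through Gordon.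
* B. J. J. Moonen, Yu. G. Zarhin, *Hodge classes on abelian varieties of low dimension*, Math. Ann. 315 (1999), held
  `paper:arxiv-math_9901113`, §2 (2.3) `g = 3` (p0005 L84–L95): «There are four cases. Type I(1): `X` is an abelian
  3-fold with `End⁰(X) = ℚ`. Then `Hg(X) = Sp(V,φ) ≅ Sp_{6,ℚ}`. Type I(3): `End⁰(X) = F` is a totally real cubic field.
  There is a unique `F`-symplectic form `ψ : V × V → F` such that `φ = trace_{F/ℚ} ψ`. The Hodge group is given by
  `Hg(X) = Res_{F/ℚ} Sp_F(V,ψ)`» (dimensions `21`, `3 · 3 = 9`); §2 (p0005 L20–L22): «For `g := dim(X) ≤ 3` […]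
  `Hg(X) = Sp_D(V,φ)` […] it follows that `ℬ•(Xⁿ) = 𝒟•(Xⁿ)` for all `n`»; Thm. (2.5) (p0006 L7–L9).
* J. S. Milne, *Lefschetz classes on abelian varieties*, Duke Math. J. 96 (1999), §2 Summary table (type I: `S(A) = Res Sp`,
  dimension `f · (g/f)(2g/f + 1) = 3g` for `f = g`), Prop. 2.1.
* H. Lange, *Abelian Varieties over the Complex Numbers* (2023), §2.6.1 Proposition (table: type I, `e ∣ g`), §5.1.5,
  §7.2.4 Exercise (4); J. E. Humphreys (1972), §1.2 (`dim 𝔰𝔩(ℓ+1, F) = (ℓ+1)² − 1`).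

## Contents

* §1 (`(K, f)` currency: `End⁰(X) = f(K)`, `K` totally real, `[K : ℚ] = g`):
  **`IsRiemannForm.finrank_hodgeGroupComplexLie_eq_three_mul_of_finrank_eq`** (`dim_ℂ 𝔤 = 3g`),
  **`IsRiemannForm.finrank_hodgeGroupLie_eq_three_mul_of_finrank_eq`**, `IsRiemannForm.zdim_hodgeGroupC_eq_three_mul_of_finrank_eq`
  (`dim Hg(X) = 3g`), `IsRiemannForm.finrank_lefschetzLie_eq_three_mul_of_finrank_eq` ∕ `…lefschetzLieRat…`
  (`dim Lf(X) = dim_ℚ Lie S(X) = 3g`).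
* §2 SIMPLE abelian varieties whose centre is a totally real field of degree `g` (maximal real multiplication; then
  `[End⁰ : F] = 1`, Albert type I with `e = g`): `Hg = Lf`, `ℬ•(Xⁿ) = 𝒟•(Xⁿ)`, `dim Hg = 3g`.
* §3 `g = 3`: Type I(3) for SIMPLE THREEFOLDS, and «a simple abelian threefold with
  totally real centre is of Type I(1) or I(3)»: `dim Hg ∈ {21, 9}` with the dictionary, stably nondegenerate in both cases.
-/

noncomputable section

open scoped Matrix
open Module Matrix NormedSpace
open Literature.NumberTheory.Automorphic (IsZConnected)
open Literature.RingTheory.CentralSimple (IsAlbertTypeI)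
open Literature.Algebra.Lie

namespace Literature.Geometry.Kaehler

namespace ComplexTorus

/-! ## §1 `dim_ℂ 𝔤 = dim_ℝ 𝔥𝔤_ℝ = dim Hg(X) = dim Lf(X) = 3g` -/

section Dimension

variable {ι : Type} [Fintype ι] [DecidableEq ι] {E : Type} [NormedAddCommGroup E] [NormedSpace ℂ E]
  [FiniteDimensional ℂ E] {Φ : (ι → ℝ) ≃L[ℝ] E} {η : E [⋀^Fin 2]→L[ℝ] ℝ} {K : Type*} [Field K] [NumberField K]
  [NumberField.IsTotallyReal K]

/-- **RIBET 1983 Thm. 1 (`d = e`) ∕ MZ99 (2.3) I(3): `dim_ℂ 𝔤 = 3g`** for a polarised complex abelian variety of dimension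
`g` whose endomorphism algebra `End⁰(X) = f(K)` is a totally real field of degree `g`: `𝔤 = Lie Hg(X)(ℂ)` restricts
isomorphically onto `∏_σ 𝔰𝔩(V_σ)` on the `g` eigenplanes of `K` («`Hg(A,ℂ) ≃ ∏_{σ ∈ Hom(K,ℂ)} Sp(U_σ, ψ_σ)`»; over `ℂ`,
`Res_{F/ℚ} SL_{2,F} = SL₂^g`, of dimension `3g`; at `g = 3`: `9`).
[cite: Gordon1997, Thm. 6.3 (sketch: "`Hg(A,ℂ) ≃ ∏_{σ ∈ Hom(K,ℂ)} Sp(U_σ, ψ_σ)`")] [cite: MoonenZarhin1999LowDim, §2 (2.3) `g = 3` («Type I(3) … `Hg(X) = Res_{F/ℚ} Sp_F(V,ψ)`»)]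
[cite: Humphreys1972, §1.2] -/
theorem IsRiemannForm.finrank_hodgeGroupComplexLie_eq_three_mul_of_finrank_eq (hη : IsRiemannForm Φ η)
    (hK : finrank ℚ K = finrank ℂ E) (f : K →ₐ[ℚ] Matrix ι ι ℚ) (hfE : f.range = endAlgRat Φ) :
    finrank ℂ (hodgeGroupComplexLie Φ) = 3 * finrank ℂ E := by
  classical
  letI : LieRing (Matrix ι ι ℂ) := LieRing.ofAssociativeRing
  letI : LieAlgebra ℂ (Matrix ι ι ℂ) := LieAlgebra.ofAssociativeAlgebra
  have hfE' : ∀ y, f y ∈ endAlgRat Φ := fun y ↦ by rw [← hfE]; exact AlgHom.mem_range_self f y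
  -- the eigenplanes
  set W : (K →+* ℂ) → Submodule ℂ (ι → ℂ) :=
    fun σ ↦ ⨅ y : K, Module.End.eigenspace (Matrix.toLin' ((f y).map (algebraMap ℚ ℂ))) (σ y) with hW
  have hd : ∀ σ, finrank ℂ (W σ) = 2 := fun σ ↦ finrank_iInf_eigenspace_eq_two_of_finrank_eq f Φ hK σ
  have htop : iSup W = ⊤ := iSup_iInf_eigenspace_toLin'_map_eq_top f
  -- a rational Gram matrix; the Rosati involution is the identity on the totally real `f(K) = End⁰(X)`
  obtain ⟨G, hGη⟩ := hη.exists_ratMatrix_latticeGram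
  have hg : 0 < finrank ℂ E := by rw [← hK]; exact Module.finrank_pos
  have hcardι : Fintype.card ι = 2 * finrank ℂ E := card_eq_two_mul_finrank Φ
  haveI : Nonempty ι := Fintype.card_pos_iff.1 (by omega)
  have hRos : ∀ A ∈ endAlgRat Φ, rosati G A = A := fun A hA ↦
    rosati_eq_self_of_range_eq Φ f hfE hη.1 hη.2.2 hGη hA
  -- `𝔊 = 𝔤`, transported to `End(ℂ^ι)` along `Matrix.toLin'`
  set 𝔊 : Submodule ℂ (Module.End ℂ (ι → ℂ)) :=
    (hodgeGroupComplexLie Φ).toSubmodule.comap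
      (LinearMap.toMatrix' : Module.End ℂ (ι → ℂ) ≃ₗ[ℂ] Matrix ι ι ℂ).toLinearMap with h𝔊def
  have hmem𝔊 : ∀ Y : Module.End ℂ (ι → ℂ), Y ∈ 𝔊 ↔ LinearMap.toMatrix' Y ∈ hodgeGroupLieC Φ := fun Y ↦ by
    rw [h𝔊def, Submodule.mem_comap, LinearEquiv.coe_coe, LieSubalgebra.mem_toSubmodule,
      mem_hodgeGroupComplexLie_iff_mem_hodgeGroupLieC]
  have hfin𝔊 : finrank ℂ 𝔊 = finrank ℂ (hodgeGroupComplexLie Φ) :=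
    (LinearEquiv.ofSubmodule' (LinearMap.toMatrix' : Module.End ℂ (ι → ℂ) ≃ₗ[ℂ] Matrix ι ι ℂ)
      (hodgeGroupComplexLie Φ).toSubmodule).finrank_eq
  have htoLin : ∀ Y : Module.End ℂ (ι → ℂ), Matrix.toLin' (LinearMap.toMatrix' Y) = Y := fun Y ↦
    Matrix.toLin'_toMatrix' Y
  -- stability and tracelessness on the eigenplanes (g50-#2 §0), surjectivity onto the traceless families (g50-#2 §1)
  have hst : ∀ (ν : K →+* ℂ), ∀ Y ∈ 𝔊, ∀ w ∈ W ν, Y w ∈ W ν := fun ν Y hY w hw ↦ by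
    have h := hη.toLin'_apply_mem_iInf_eigenspace_algHom_of_mem_hodgeGroupLieC f hfE' hGη ν ((hmem𝔊 Y).1 hY) w hw
    rwa [htoLin] at h
  have hcard : Fintype.card (K →+* ℂ) = finrank ℂ E := by rw [NumberField.Embeddings.card, hK]
  rw [← hfin𝔊, ← hcard]
  refine finrank_eq_three_mul_card_of_iSup_eq_top W htop hd 𝔊 hst (fun ν Y hY ↦ ?_) fun Y hY ↦ ?_
  · have hZW : ∀ u ∈ W ν, Matrix.toLin' (LinearMap.toMatrix' Y) u ∈ W ν := fun u hu ↦ by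
      rw [htoLin]; exact hst ν Y hY u hu
    have h := hη.forall_trace_restrict_eq_zero_of_mem_hodgeGroupLieC' f hfE' hGη hRos ν ((hmem𝔊 Y).1 hY) hZW
    have heq : (Matrix.toLin' (LinearMap.toMatrix' Y)).restrict hZW = Y.restrict (hst ν Y hY) :=
      LinearMap.ext fun w ↦ Subtype.ext (by rw [LinearMap.coe_restrict_apply, LinearMap.coe_restrict_apply, htoLin])
    rwa [heq] at h
  · obtain ⟨Z, hZ, hZY⟩ := hη.exists_mem_hodgeGroupLieC_forall_mulVec_eq_of_finrank_eq hK f hfE (W := W)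
      (fun _ ↦ rfl) Y hY
    refine ⟨Matrix.toLin' Z, ?_, fun σ w ↦ ?_⟩
    · rw [hmem𝔊, LinearMap.toMatrix'_toLin']; exact hZ
    · rw [Matrix.toLin'_apply]; exact hZY σ w

/-- **`dim_ℝ 𝔥𝔤_ℝ = 3g`** (`𝔥𝔤_ℝ ≅ 𝔰𝔩₂(ℝ)^g`, the Lie algebra of `Res_{F/ℚ} SL_{2,F}(ℝ) = SL₂(ℝ)^g`).
[cite: Gordon1997, Thm. 6.3] [cite: MoonenZarhin1999LowDim, §2 (2.3) `g = 3` («Type I(3)»)] -/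
theorem IsRiemannForm.finrank_hodgeGroupLie_eq_three_mul_of_finrank_eq (hη : IsRiemannForm Φ η)
    (hK : finrank ℚ K = finrank ℂ E) (f : K →ₐ[ℚ] Matrix ι ι ℚ) (hfE : f.range = endAlgRat Φ) :
    finrank ℝ (hodgeGroupLie Φ) = 3 * finrank ℂ E := by
  rw [← finrank_hodgeGroupComplexLie_eq_finrank_hodgeGroupLie Φ]
  exact hη.finrank_hodgeGroupComplexLie_eq_three_mul_of_finrank_eq hK f hfE

/-- **`dim Hg(X) = 3g`** (the trunk's dimension of the connected algebraic group `Hg(X)(ℂ) ≤ GL(V_ℂ)`; Milne's type I row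
`f · (g/f)(2g/f + 1)` with `f = g`). [cite: MoonenZarhin1999LowDim, §2 (2.3) `g = 3` («Type I(3) … `Hg(X) = Res_{F/ℚ} Sp_F(V,ψ)`»)]
[cite: Milne1999LefschetzClasses, §2 Summary table (type I)] [cite: GoodmanWallachGTM255, §1.4.4 Thm. 1.4.10] -/
theorem IsRiemannForm.zdim_hodgeGroupC_eq_three_mul_of_finrank_eq (hη : IsRiemannForm Φ η)
    (hK : finrank ℚ K = finrank ℂ E) (f : K →ₐ[ℚ] Matrix ι ι ℚ) (hfE : f.range = endAlgRat Φ) :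
    (isZConnected_map_toGL_hodgeGroupC Φ).zdim = 3 * finrank ℂ E :=
  (zdim_hodgeGroupC_eq_iff_finrank_hodgeGroupLie_eq Φ).2 (hη.finrank_hodgeGroupLie_eq_three_mul_of_finrank_eq hK f hfE)

/-- **`dim_ℝ 𝔩𝔣 = dim Lf(X) = 3g`** (`Lf(X) = S(X) = Res_{F/ℚ} Sp_F(V,ψ)`, Milne's type I row; equal to `dim Hg(X)` since
`Hg(X) = Lf(X)`, g50-#3). [cite: Milne1999LefschetzClasses, §2 Summary table (type I: `Res Sp`, dimension)]
[cite: Gordon1997, Thm. 6.3 («`Hg(A) = Lf(A)`»)] -/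
theorem IsRiemannForm.finrank_lefschetzLie_eq_three_mul_of_finrank_eq (hη : IsRiemannForm Φ η)
    (hK : finrank ℚ K = finrank ℂ E) (f : K →ₐ[ℚ] Matrix ι ι ℚ) (hfE : f.range = endAlgRat Φ)
    {G : Matrix ι ι ℚ} (hGη : G.map (Rat.cast : ℚ → ℝ) = latticeGram Φ η) :
    finrank ℝ (lefschetzLie Φ G) = 3 * finrank ℂ E := by
  rw [← (hη.hodgeGroupC_eq_lefschetzIdentityC_iff_finrank_eq hGη).1
    (hη.hodgeGroupC_eq_lefschetzIdentityC_of_finrank_eq hK f hfE hGη)]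
  exact hη.finrank_hodgeGroupLie_eq_three_mul_of_finrank_eq hK f hfE

/-- **`dim_ℚ Lie S(X) = 3g`** (`Lie S(X) = 𝔰𝔭_F(V, ψ) = 𝔰𝔩_{2,F}`, `dim_ℚ = [F:ℚ] · 3`). [cite: Milne1999LefschetzClasses, §1 (p. 644) and §2 Summary table (type I)]
[cite: MoonenZarhin1999LowDim, §2 (2.3) `g = 3` («Type I(3)»)] -/
theorem IsRiemannForm.finrank_lefschetzLieRat_eq_three_mul_of_finrank_eq (hη : IsRiemannForm Φ η)
    (hK : finrank ℚ K = finrank ℂ E) (f : K →ₐ[ℚ] Matrix ι ι ℚ) (hfE : f.range = endAlgRat Φ)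
    {G : Matrix ι ι ℚ} (hGη : G.map (Rat.cast : ℚ → ℝ) = latticeGram Φ η) :
    finrank ℚ (lefschetzLieRat Φ G) = 3 * finrank ℂ E := by
  rw [finrank_lefschetzLieRat_eq_finrank_lefschetzLie]
  exact hη.finrank_lefschetzLie_eq_three_mul_of_finrank_eq hK f hfE hGη

end Dimension

/-! ## §2 Simple abelian varieties with maximal real multiplication (`End⁰(X) = F` totally real of degree `g`) -/

section Simple

variable {κ : Type} [Fintype κ] [DecidableEq κ] [Nonempty κ] {E : Type} [NormedAddCommGroup E] [NormedSpace ℂ E]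
  [FiniteDimensional ℂ E] {Ψ : (κ → ℝ) ≃L[ℝ] E} {η : E [⋀^Fin 2]→L[ℝ] ℝ} {G : Matrix κ κ ℚ}

/-- **A centre of degree `g` is the whole endomorphism algebra**: for a simple complex torus of dimension `g` whose centre
`F = Z(End⁰(X))` has `[F : ℚ] = g`, `[End⁰(X) : F] = 1` — `[End⁰ : F] = d²` and `e · d² ∣ 2g = 2e` (Lange's table) force
`d = 1`; in particular types II and III (`2e ∣ g`) do not occur with `e = g`. [cite: Lange2023AbelianVarietiesComplex, §2.6.1 Proposition (table: `d² e ∣ 2g`, «restriction»)]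
[cite: MumfordAV1970, §21 (table)] -/
theorem IsSimple.finrank_centerField_endAlgRat_eq_one_of_finrank_centerField_eq (hX : IsSimple Ψ)
    (he : finrank ℚ (centerField Ψ hX) = finrank ℂ E) : finrank (centerField Ψ hX) (endAlgRat Ψ) = 1 := by
  obtain ⟨d, hd⟩ := hX.exists_sq_eq_finrank_centerField_endAlgRat
  have hdvd := hX.finrank_centerField_mul_finrank_dvd
  rw [← he, mul_comm 2] at hdvd
  have he0 : 0 < finrank ℚ (centerField Ψ hX) := finrank_pos
  have hm : finrank (centerField Ψ hX) (endAlgRat Ψ) ∣ 2 := Nat.dvd_of_mul_dvd_mul_left he0 hdvd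
  have hm2 := Nat.le_of_dvd two_pos hm
  rw [← hd] at hm hm2 ⊢
  have hd1 : d ≤ 1 := by nlinarith
  interval_cases d
  · simp at hm
  · norm_num

/-- **MAXIMAL REAL MULTIPLICATION, `Hg(X)(ℝ) = Lf(X)(ℝ)`**: a simple polarised abelian variety of dimension `g` whose
centre `F = Z(End⁰(X))` is a totally real field of degree `g` (then `End⁰(X) = F`: Albert type I with `e = g`,
`d = 1`) has `Hg(X) = Lf(X)`. [cite: Gordon1997, Thm. 6.3 («`End⁰A` is a totally real field of degree `e` … `d/e` is odd … `Hg(A) = Lf(A)`»)]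
[cite: Lange2023AbelianVarietiesComplex, §2.6.1 Proposition (table, type I, `d = 1`, `e ∣ g`)] -/
theorem IsSimple.hodgeGroup_eq_lefschetzIdentity_of_finrank_centerField_eq (hX : IsSimple Ψ)
    [NumberField.IsTotallyReal (centerField Ψ hX)] (hη : IsRiemannForm Ψ η)
    (hG : G.map (Rat.cast : ℚ → ℝ) = latticeGram Ψ η) (he : finrank ℚ (centerField Ψ hX) = finrank ℂ E) :
    hodgeGroup Ψ = lefschetzIdentity Ψ G :=
  hη.hodgeGroup_eq_lefschetzIdentity_of_finrank_eq he (centerField.valAlgHom Ψ hX)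
    (hX.range_valAlgHom_eq_endAlgRat_of_finrank_eq_one
      (hX.finrank_centerField_endAlgRat_eq_one_of_finrank_centerField_eq he)) hG

/-- **MAXIMAL REAL MULTIPLICATION IS STABLY NONDEGENERATE**: `ℬ•(Xⁿ) = 𝒟•(Xⁿ)` for every `n` for a simple polarised
abelian variety whose centre is a totally real field of degree `g = dim X` («`Hg(A) = Lf(A)` and thus
`Hdg(Aⁿ) = Div(Aⁿ)` for `n ≥ 1`»). [cite: Gordon1997, Thm. 6.3 and Thm. 6.2] [cite: MoonenZarhin1999LowDim, §2 (p0005 L20–L22) and (2.3) `g = 3` («Type I(3)»)] -/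
theorem IsSimple.forall_divisorClasses_powPeriod_eq_hodgeClasses_of_finrank_centerField_eq (hX : IsSimple Ψ)
    [NumberField.IsTotallyReal (centerField Ψ hX)] (hη : IsRiemannForm Ψ η)
    (he : finrank ℚ (centerField Ψ hX) = finrank ℂ E) :
    ∀ k p : ℕ, divisorClasses (powPeriod Ψ k) p = hodgeClasses (powPeriod Ψ k) p :=
  hη.forall_divisorClasses_powPeriod_eq_hodgeClasses_of_finrank_eq he (centerField.valAlgHom Ψ hX)
    (hX.range_valAlgHom_eq_endAlgRat_of_finrank_eq_one
      (hX.finrank_centerField_endAlgRat_eq_one_of_finrank_centerField_eq he))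

/-- **MAXIMAL REAL MULTIPLICATION: `dim_ℝ 𝔥𝔤_ℝ = dim Hg(X) = 3g`.** [cite: Gordon1997, Thm. 6.3 (sketch)] [cite: MoonenZarhin1999LowDim, §2 (2.3) `g = 3` («Type I(3)»)] -/
theorem IsSimple.finrank_hodgeGroupLie_eq_three_mul_of_finrank_centerField_eq (hX : IsSimple Ψ)
    [NumberField.IsTotallyReal (centerField Ψ hX)] (hη : IsRiemannForm Ψ η)
    (he : finrank ℚ (centerField Ψ hX) = finrank ℂ E) : finrank ℝ (hodgeGroupLie Ψ) = 3 * finrank ℂ E :=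
  hη.finrank_hodgeGroupLie_eq_three_mul_of_finrank_eq he (centerField.valAlgHom Ψ hX)
    (hX.range_valAlgHom_eq_endAlgRat_of_finrank_eq_one
      (hX.finrank_centerField_endAlgRat_eq_one_of_finrank_centerField_eq he))

/-- **Albert type I with `e = [F : ℚ] = g`: `Hg(X)(ℝ) = Lf(X)(ℝ)`** — the Rosati pair `(End⁰(X), ′)` of Albert type I
over a totally real centre of degree `g` (`[End⁰ : F] = 1` is part of type I). [cite: Gordon1997, Thm. 6.3]
[cite: Lange2023AbelianVarietiesComplex, §2.6.1 Proposition (table, type I) and §5.5] -/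
theorem IsSimple.hodgeGroup_eq_lefschetzIdentity_of_isAlbertTypeI_of_finrank_centerField_eq (hX : IsSimple Ψ)
    (hη : IsRiemannForm Ψ η) (hG : G.map (Rat.cast : ℚ → ℝ) = latticeGram Ψ η)
    (h : IsAlbertTypeI (centerField Ψ hX) (endAlgRat Ψ) (rosatiEnd Ψ hη.1 hη.2.2 hG))
    (he : finrank ℚ (centerField Ψ hX) = finrank ℂ E) : hodgeGroup Ψ = lefschetzIdentity Ψ G := by
  haveI : NumberField.IsTotallyReal (centerField Ψ hX) := h.isTotallyReal
  exact hX.hodgeGroup_eq_lefschetzIdentity_of_finrank_centerField_eq hη hG he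

/-- **Albert type I with `e = g`: stably nondegenerate.** [cite: Gordon1997, Thm. 6.3 and Thm. 6.2] [cite: MoonenZarhin1999LowDim, §2 (p0005 L20–L22)] -/
theorem IsSimple.forall_divisorClasses_powPeriod_eq_hodgeClasses_of_isAlbertTypeI_of_finrank_centerField_eq
    (hX : IsSimple Ψ) (hη : IsRiemannForm Ψ η) (hG : G.map (Rat.cast : ℚ → ℝ) = latticeGram Ψ η)
    (h : IsAlbertTypeI (centerField Ψ hX) (endAlgRat Ψ) (rosatiEnd Ψ hη.1 hη.2.2 hG))
    (he : finrank ℚ (centerField Ψ hX) = finrank ℂ E) :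
    ∀ k p : ℕ, divisorClasses (powPeriod Ψ k) p = hodgeClasses (powPeriod Ψ k) p := by
  haveI : NumberField.IsTotallyReal (centerField Ψ hX) := h.isTotallyReal
  exact hX.forall_divisorClasses_powPeriod_eq_hodgeClasses_of_finrank_centerField_eq hη he

/-- **Albert type I with `e = g`: `dim_ℝ 𝔥𝔤_ℝ = 3g`.** [cite: Gordon1997, Thm. 6.3 (sketch)] [cite: Lange2023AbelianVarietiesComplex, §2.6.1 Proposition (table, type I)] -/
theorem IsSimple.finrank_hodgeGroupLie_eq_three_mul_of_isAlbertTypeI_of_finrank_centerField_eq (hX : IsSimple Ψ)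
    (hη : IsRiemannForm Ψ η) (hG : G.map (Rat.cast : ℚ → ℝ) = latticeGram Ψ η)
    (h : IsAlbertTypeI (centerField Ψ hX) (endAlgRat Ψ) (rosatiEnd Ψ hη.1 hη.2.2 hG))
    (he : finrank ℚ (centerField Ψ hX) = finrank ℂ E) : finrank ℝ (hodgeGroupLie Ψ) = 3 * finrank ℂ E := by
  haveI : NumberField.IsTotallyReal (centerField Ψ hX) := h.isTotallyReal
  exact hX.finrank_hodgeGroupLie_eq_three_mul_of_finrank_centerField_eq hη he

end Simple

/-! ## §3 Simple abelian threefolds: Moonen–Zarhin (2.3) Type I(3), and «totally real centre ⟹ Type I(1) or I(3)» -/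

section Threefold

variable {κ : Type} [Fintype κ] [DecidableEq κ] [Nonempty κ] {E : Type} [NormedAddCommGroup E] [NormedSpace ℂ E]
  [FiniteDimensional ℂ E] {Ψ : (κ → ℝ) ≃L[ℝ] E} {η : E [⋀^Fin 2]→L[ℝ] ℝ} {G : Matrix κ κ ℚ}

/-- **MOONEN–ZARHIN (2.3), TYPE I(3): `Hg(X)(ℝ) = Lf(X)(ℝ)` (`= Res_{F/ℚ} SL_{2,F}(ℝ)`)** for a simple polarised abelian
THREEFOLD whose centre is a totally real CUBIC field (then `End⁰(X) = F`: the endomorphism algebra of a simple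
threefold is its centre). [cite: MoonenZarhin1999LowDim, §2 (2.3) `g = 3` («Type I(3): `End⁰(X) = F` is a totally real cubic field … `Hg(X) = Res_{F/ℚ} Sp_F(V,ψ)`»)]
[cite: Gordon1997, Thm. 6.3] -/
theorem IsSimple.hodgeGroup_eq_lefschetzIdentity_of_finrank_centerField_eq_three (hX : IsSimple Ψ)
    [NumberField.IsTotallyReal (centerField Ψ hX)] (hη : IsRiemannForm Ψ η)
    (hG : G.map (Rat.cast : ℚ → ℝ) = latticeGram Ψ η) (he : finrank ℚ (centerField Ψ hX) = 3)
    (h3 : finrank ℂ E = 3) : hodgeGroup Ψ = lefschetzIdentity Ψ G :=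
  hX.hodgeGroup_eq_lefschetzIdentity_of_finrank_centerField_eq hη hG (he.trans h3.symm)

/-- **MOONEN–ZARHIN (2.3), TYPE I(3): stably nondegenerate** — `ℬ•(Xⁿ) = 𝒟•(Xⁿ)` for every `n` for a simple polarised
abelian threefold with multiplication by a totally real cubic field («for `g ≤ 3` … `ℬ•(Xⁿ) = 𝒟•(Xⁿ)` for all `n`»; Thm.
(2.5): prime dimension). [cite: MoonenZarhin1999LowDim, §2 (p0005 L20–L22), (2.3) `g = 3` («Type I(3)») and Thm. (2.5)] [cite: Gordon1997, Thm. 6.3 and Corollary («simple abelian variety of prime dimension»)] -/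
theorem IsSimple.forall_divisorClasses_powPeriod_eq_hodgeClasses_of_finrank_centerField_eq_three (hX : IsSimple Ψ)
    [NumberField.IsTotallyReal (centerField Ψ hX)] (hη : IsRiemannForm Ψ η) (he : finrank ℚ (centerField Ψ hX) = 3)
    (h3 : finrank ℂ E = 3) : ∀ k p : ℕ, divisorClasses (powPeriod Ψ k) p = hodgeClasses (powPeriod Ψ k) p :=
  hX.forall_divisorClasses_powPeriod_eq_hodgeClasses_of_finrank_centerField_eq hη (he.trans h3.symm)

/-- **MOONEN–ZARHIN (2.3), TYPE I(3): `dim_ℝ 𝔥𝔤_ℝ = dim Hg(X) = 9`** (`Res_{F/ℚ} SL_{2,F}`, `[F:ℚ] = 3`).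
[cite: MoonenZarhin1999LowDim, §2 (2.3) `g = 3` («Type I(3) … `Hg(X) = Res_{F/ℚ} Sp_F(V,ψ)`»)] [cite: Milne1999LefschetzClasses, §2 Summary table (type I)] -/
theorem IsSimple.finrank_hodgeGroupLie_eq_nine_of_finrank_centerField_eq_three (hX : IsSimple Ψ)
    [NumberField.IsTotallyReal (centerField Ψ hX)] (hη : IsRiemannForm Ψ η) (he : finrank ℚ (centerField Ψ hX) = 3)
    (h3 : finrank ℂ E = 3) : finrank ℝ (hodgeGroupLie Ψ) = 9 := by
  rw [hX.finrank_hodgeGroupLie_eq_three_mul_of_finrank_centerField_eq hη (he.trans h3.symm), h3]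

/-- **A simple abelian THREEFOLD with TOTALLY REAL centre is of Type I(1) (`End⁰(X) = ℚ`, `e = 1`) or of Type I(3)
(`End⁰(X)` a totally real cubic field, `e = 3`)**: `e = [F : ℚ]` divides `g = 3` (Lange's table), and `End⁰(X) = F`.
[cite: MoonenZarhin1999LowDim, §2 (2.3) `g = 3` («There are four cases. Type I(1) … Type I(3) …»)] [cite: Lange2023AbelianVarietiesComplex, §2.6.1 Proposition (table, «restriction» `e ∣ g`)] -/
theorem IsSimple.finrank_centerField_eq_one_or_eq_three_of_isTotallyReal (hX : IsSimple Ψ)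
    [NumberField.IsTotallyReal (centerField Ψ hX)] (h3 : finrank ℂ E = 3) :
    finrank ℚ (centerField Ψ hX) = 1 ∨ finrank ℚ (centerField Ψ hX) = 3 := by
  have hdvd : finrank ℚ (centerField Ψ hX) ∣ 3 := h3 ▸ hX.finrank_centerField_dvd_of_isTotallyReal
  have hpos : 0 < finrank ℚ (centerField Ψ hX) := finrank_pos
  have hle : finrank ℚ (centerField Ψ hX) ≤ 3 := Nat.le_of_dvd (by norm_num) hdvd
  interval_cases h : finrank ℚ (centerField Ψ hX)
  · exact Or.inl rfl
  · exact absurd hdvd (by norm_num)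
  · exact Or.inr rfl

/-- **MZ99 (2.3) FOR SIMPLE THREEFOLDS WITH TOTALLY REAL CENTRE: `ℬ•(Xⁿ) = 𝒟•(Xⁿ)` for every `n`** — Type I(1)
(`Hg = Sp₆`, the tree's `ComplexTorusAbelianSurfaceHodgeGeneral` §g=3) or Type I(3) (this file).
[cite: MoonenZarhin1999LowDim, §2 (p0005 L20–L22: «for `g := dim(X) ≤ 3` … `ℬ•(Xⁿ) = 𝒟•(Xⁿ)` for all `n`») and (2.3) `g = 3`] [cite: Gordon1997, Corollary to Thm. 6.3] -/
theorem IsSimple.forall_divisorClasses_powPeriod_eq_hodgeClasses_of_isTotallyReal_of_finrank_eq_three (hX : IsSimple Ψ)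
    [NumberField.IsTotallyReal (centerField Ψ hX)] (hη : IsRiemannForm Ψ η) (h3 : finrank ℂ E = 3) :
    ∀ k p : ℕ, divisorClasses (powPeriod Ψ k) p = hodgeClasses (powPeriod Ψ k) p := by
  rcases hX.finrank_centerField_eq_one_or_eq_three_of_isTotallyReal h3 with he | he
  · exact hη.forall_divisorClasses_eq_hodgeClasses_powPeriod_of_finrank_eq_three_of_endAlgRat_eq_bot h3
      (hX.endAlgRat_eq_bot_of_finrank_eq_one_of_finrank_centerField_eq_one
        (hX.finrank_centerField_endAlgRat_eq_one_of_finrank_eq_three h3) he)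
  · exact hX.forall_divisorClasses_powPeriod_eq_hodgeClasses_of_finrank_centerField_eq_three hη he h3

/-- **THE DICTIONARY FOR SIMPLE THREEFOLDS WITH TOTALLY REAL CENTRE: `dim_ℝ 𝔥𝔤_ℝ = 21` (Type I(1), `End⁰(X) = ℚ`,
`Hg = Sp₆`) or `dim_ℝ 𝔥𝔤_ℝ = 9` (Type I(3), `Hg = Res_{F/ℚ} SL_{2,F}`), according as `e = 1` or `e = 3`.**
[cite: MoonenZarhin1999LowDim, §2 (2.3) `g = 3` («Type I(1) … `Hg(X) = Sp(V,φ) ≅ Sp_{6,ℚ}` … Type I(3) … `Hg(X) = Res_{F/ℚ} Sp_F(V,ψ)`»)] [cite: Humphreys1972, §1.2 (`dim 𝔰𝔭₆ = 21`, `dim 𝔰𝔩₂ = 3`)] -/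
theorem IsSimple.finrank_hodgeGroupLie_eq_of_isTotallyReal_of_finrank_eq_three (hX : IsSimple Ψ)
    [NumberField.IsTotallyReal (centerField Ψ hX)] (hη : IsRiemannForm Ψ η) (h3 : finrank ℂ E = 3) :
    (finrank ℚ (centerField Ψ hX) = 1 ∧ finrank ℝ (hodgeGroupLie Ψ) = 21) ∨
      (finrank ℚ (centerField Ψ hX) = 3 ∧ finrank ℝ (hodgeGroupLie Ψ) = 9) := by
  rcases hX.finrank_centerField_eq_one_or_eq_three_of_isTotallyReal h3 with he | he
  · exact Or.inl ⟨he, hη.finrank_hodgeGroupLie_eq_of_finrank_eq_three_of_endAlgRat_eq_bot h3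
      (hX.endAlgRat_eq_bot_of_finrank_eq_one_of_finrank_centerField_eq_one
        (hX.finrank_centerField_endAlgRat_eq_one_of_finrank_eq_three h3) he)⟩
  · exact Or.inr ⟨he, hX.finrank_hodgeGroupLie_eq_nine_of_finrank_centerField_eq_three hη he h3⟩

/-- **Simple threefold with totally real centre: `dim_ℝ 𝔥𝔤_ℝ ∈ {9, 21}`.** [cite: MoonenZarhin1999LowDim, §2 (2.3) `g = 3`] -/
theorem IsSimple.finrank_hodgeGroupLie_mem_of_isTotallyReal_of_finrank_eq_three (hX : IsSimple Ψ)
    [NumberField.IsTotallyReal (centerField Ψ hX)] (hη : IsRiemannForm Ψ η) (h3 : finrank ℂ E = 3) :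
    finrank ℝ (hodgeGroupLie Ψ) ∈ ({9, 21} : Finset ℕ) := by
  simp only [Finset.mem_insert, Finset.mem_singleton]
  rcases hX.finrank_hodgeGroupLie_eq_of_isTotallyReal_of_finrank_eq_three hη h3 with ⟨-, h⟩ | ⟨-, h⟩
  · exact Or.inr h
  · exact Or.inl h

/-- **Dictionary, converse direction: `dim_ℝ 𝔥𝔤_ℝ = 9 ⟺ e = 3`** for a simple threefold with totally real centre.
[cite: MoonenZarhin1999LowDim, §2 (2.3) `g = 3`] -/
theorem IsSimple.finrank_hodgeGroupLie_eq_nine_iff_finrank_centerField_eq_three_of_isTotallyReal (hX : IsSimple Ψ)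
    [NumberField.IsTotallyReal (centerField Ψ hX)] (hη : IsRiemannForm Ψ η) (h3 : finrank ℂ E = 3) :
    finrank ℝ (hodgeGroupLie Ψ) = 9 ↔ finrank ℚ (centerField Ψ hX) = 3 := by
  rcases hX.finrank_hodgeGroupLie_eq_of_isTotallyReal_of_finrank_eq_three hη h3 with ⟨he, h⟩ | ⟨he, h⟩
  · rw [he, h]; norm_num
  · rw [he, h]; norm_num

end Threefold

end ComplexTorus

end Literature.Geometry.Kaehler
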